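import Summits.ABC.IUTFork.Cor312GapWitnessContentful
import HarnessLib

/-!
# [IUTchIII] Cor. 3.12 — over a CONTENTFUL typed-Thm-3.11 instance the typed Corollary is decided by the free Θ-glue alone

Record-only file (D-0012) of the abc-iut cell (WAVE-5 prover seat abc-iut-w5-d043; support piece for
`HOME/plan/ADJUDICATION-SPEC.md` §2 (G3) wording, written while auditing abc-iut-w5-d247's
`Cor312GapWitnessContentful.lean` p415889); TAKES NO SIDE.

abc-iut-w5-d247's contentful gap witness (`NaiveWitness.thm311_contentful_not_imp_statement`) instantiates the
typed Theorem 3.11 (i) ∧ (ii) ∧ (iii) NON-DEGENERATELY (`naiveFull p`: nonzero theta values `±p^{j²}` in the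
splitting monoids, proper shells, sign-twisted Kummer transport, non-trivial link data) and, over it, takes the
verbatim `Cor312.Setting` `naiveSetting p` with the consistently-identified glue (Θ-pilot ↦ the ball `B_{j²}` of
radius `|p^{j²}|`, q-pilot ↦ `B_1`), for which the typed Corollary 3.12 FAILS.  In the FROZEN `Cor312.Setting`
the Θ-glue `thetaRegionOf` is a FREE field («GLUE (RESIDUAL R1)» in its docstring): no typed constraint ties it to
the Situation's Thm. 3.11 (ii) data; the bridge hypotheses tie it only to the (i)-side containers
(admissibility, monotonicity, hulls).  THIS file makes that kernel-visible at the contentful instance: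

* §1 `glueSetting p k` — `naiveSetting p` with ONLY the Θ-glue replaced by the constant ball `B_k` (every other
  field — lattice, Prop. 3.7 signature, splitting monoids, q-data, q-glue, hull frame — definitionally the same);
* §2 its volumes: `−|log(Θ)| = −k·log p` (`glueSetting_negLogTheta`), `−|log(q)| = −log p`; all bridge
  hypotheses and `|log(q)| > 0` hold for EVERY `k` (`glueSetting_bridgeHyps`, `glueSetting_absLogQPos`);
* §3 **`glueSetting_statement_iff : (glueSetting p k).Statement ↔ k ≤ 1`** — over one and the same contentful
  Thm. 3.11 instance the typed Corollary is EQUIVALENT to a condition on the free glue parameter alone; packaged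
  as `statement_decided_by_glue_over_contentful_thm311` (∃ T F P P′ over the same `F` with `F.Statement`, both
  settings satisfying the bridge hypotheses and `|log(q)| > 0`, `¬ P.Statement` and `P′.Statement`).

WHAT THIS SAYS for the (G3) sentence (and nothing more): the (G3) countermodels — degenerate (A1's
`GapWitness.thm311_bridgeHyps_not_imp_statement`) or contentful (p415889) — certify non-derivability of the
Statement from the TYPED INTERFACES; «contentful» qualifies the Thm. 3.11 instance, not the tie across the link,
because at this typing there is no such tie (it is RESIDUAL R1, i.e. GAP-LEDGER row G-c312-9-1 / Step (xi-f),
kurims `paper:url-4b091feeb646` p. 184 l. 19–24).  Same phenomenon at the degenerate instance: abc-iut-w5-d236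
`Cor312SoundInputWitness` (soundSetting vs gapSetting), abc-iut-w5-d211 `soundAtInput_depends_on_gluing`.
HONEST SCOPE: interface level; nothing about the assembled real setting; no judgement on print; no `Prop`
fact. [claim: Mochizuki2012, status: disputed] [cite: ScholzeStix2018, §2.2 pp. 9–10]
-/

noncomputable section

namespace Summit.ABC

namespace IUTFork

namespace Cor312Vol

namespace NaiveWitness

open Thm311 Cor312 Cor312.Checks Cor312.IdentifiedNonVacuity Literature.IUT.LogThetaLattice

variable (p : ℕ) [hp : Fact p.Prime] (k : ℤ)

/-! ## 1. The one-parameter family of glues over the contentful instance -/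

/-- **The glue-`k` setting**: abc-iut-w5-d247's `naiveSetting p` over the contentful situation `naiveSituation p`
with ONLY the free Θ-glue field changed — at every lattice position and every `(j, v_ℚ)` the Θ-pilot object maps
to the ball `B_k` of radius `p^{−k}`; q-glue, hull frame, lattice, Prop. 3.7 signature, splitting monoids and
q-data are untouched (RESIDUAL R1 of the frozen `Cor312.Setting` is a free field).
[claim: Mochizuki2012, status: disputed] -/
def glueSetting : Setting (naiveSituation p) :=
  { naiveSetting p with thetaRegionOf := fun _ _ j vQ => pBall p j vQ k }

omit hp in
/-- The glue-`k` setting has the same q-glue as `naiveSetting` (definitional). [folklore] -/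
theorem glueSetting_qRegionOf : (glueSetting p k).qRegionOf = (naiveSetting p).qRegionOf := rfl

omit hp in
/-- … the same hull frame (definitional). [folklore] -/
theorem glueSetting_frame : (glueSetting p k).frame = (naiveSetting p).frame := rfl

omit hp in
/-- … the same log-theta-lattice (definitional). [folklore] -/
theorem glueSetting_lattice : (glueSetting p k).lattice = (naiveSetting p).lattice := rfl

omit hp in
/-- … the same Prop. 3.7 output, splitting monoids and q-pilot data (definitional). [folklore] -/
theorem glueSetting_sig_split_qData :
    (glueSetting p k).sig = (naiveSetting p).sig ∧ (glueSetting p k).split = (naiveSetting p).split ∧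
      (glueSetting p k).qData = (naiveSetting p).qData := ⟨rfl, rfl, rfl⟩

omit hp in
/-- The (Ind3)-enlarged Θ-pilot region of the glue-`k` setting is `B_k`. [folklore] -/
theorem glueSetting_thetaRegion3 (j : toyIndex.Label) (vQ : toyIndex.VQ) :
    (glueSetting p k).thetaRegion3 j vQ = pBall p j vQ k :=
  Set.iUnion_const _

omit hp in
/-- The possible images of the Θ-pilot object are exactly `{B_k}` ((Ind1), (Ind2) act by isometries —
abc-iut-w5-d247's `image_pBall_of_mem_closure`). [folklore] -/
theorem glueSetting_mem_possibleImages_iff (j : toyIndex.Label) (vQ : toyIndex.VQ)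
    (U : Set (signShells.Packet j vQ)) :
    U ∈ (glueSetting p k).possibleImages j vQ ↔ U = pBall p j vQ k := by
  constructor
  · rintro ⟨Φ, hΦ, rfl⟩
    rw [glueSetting_thetaRegion3]
    exact image_pBall_of_mem_closure p hΦ j vQ _
  · rintro rfl
    rw [← glueSetting_thetaRegion3]
    exact (glueSetting p k).thetaRegion3_mem_possibleImages j vQ

omit hp in
/-- The union of the possible images is `B_k`. [folklore] -/
theorem glueSetting_sUnion_possibleImages (j : toyIndex.Label) (vQ : toyIndex.VQ) :
    ⋃₀ (glueSetting p k).possibleImages j vQ = pBall p j vQ k := by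
  have h : (glueSetting p k).possibleImages j vQ = {pBall p j vQ k} :=
    Set.ext fun U => by rw [glueSetting_mem_possibleImages_iff, Set.mem_singleton_iff]
  rw [h, Set.sUnion_singleton]

/-! ## 2. Volumes and bridge hypotheses, for every `k` -/

/-- Every union of possible images admits its hull. [folklore] -/
theorem glueSetting_hullDefined (j : toyIndex.Label) (vQ : toyIndex.VQ) :
    (glueSetting p k).HullDefined j vQ := by
  show (pFrame p j vQ).IsBounded (⋃₀ (glueSetting p k).possibleImages j vQ) ∧
    (pFrame p j vQ).HasHull (⋃₀ (glueSetting p k).possibleImages j vQ)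
  rw [glueSetting_sUnion_possibleImages]
  exact pFrame_bounded_hasHull p j vQ _

/-- The local Θ-term at `(j, v_ℚ)` is `μ(B_k) = −k·log p`. [folklore] -/
theorem glueSetting_thetaLocal (j : toyIndex.Label) (vQ : toyIndex.VQ) :
    (glueSetting p k).thetaLocal j vQ = ((-(k : ℝ) * Real.log p : ℝ) : WithTop ℝ) := by
  unfold Setting.thetaLocal
  rw [if_pos (glueSetting_hullDefined p k j vQ)]
  show ((pVol p j vQ ((pFrame p j vQ).hull (⋃₀ (glueSetting p k).possibleImages j vQ)) : ℝ) :
      WithTop ℝ) = _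
  rw [glueSetting_sUnion_possibleImages, pFrame_hull_pBall, pVol_pBall]

/-- "`−|log(Θ)|` is finite" in the glue-`k` setting. [folklore] -/
theorem glueSetting_thetaFinite : (glueSetting p k).ThetaFinite :=
  ⟨fun i vQ => by rw [glueSetting_thetaLocal]; exact WithTop.coe_ne_top, fun _ => Set.toFinite _⟩

/-- **`−|log(Θ)| = −k·log p`** in the glue-`k` setting (procession-normalised average of a constant).
[folklore] -/
theorem glueSetting_negLogTheta :
    (glueSetting p k).negLogTheta = ((-(k : ℝ) * Real.log p : ℝ) : WithTop ℝ) := by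
  unfold Setting.negLogTheta
  rw [if_pos (glueSetting_thetaFinite p k)]
  have h : (fun i : Fin toyIndex.lstar =>
      ∑ᶠ vQ : toyIndex.VQ, ((glueSetting p k).thetaLocal (Setting.labelSucc i) vQ).untopD 0) =
      fun _ => -(k : ℝ) * Real.log p := by
    funext i
    rw [finsum_unique, glueSetting_thetaLocal, WithTop.untopD_coe]
  rw [h]
  congr 1
  exact processionNormalized_const (by decide) _

/-- `−|log(q)| = −log p` (the q-glue is untouched). [folklore] -/
theorem glueSetting_negLogQ : (glueSetting p k).negLogQ = -Real.log p := naiveSetting_negLogQ p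

/-- `|log(q)| > 0` in the glue-`k` setting. [folklore] -/
theorem glueSetting_absLogQPos : (glueSetting p k).AbsLogQPos := naiveSetting_absLogQPos p

/-- **All bridge hypotheses hold** in the glue-`k` setting, for every `k`. [folklore] -/
theorem glueSetting_bridgeHyps : BridgeHyps (glueSetting p k) where
  mono := (naiveSetting_bridgeHyps p).mono
  image_adm := fun i vQ U hU => ⟨k, (glueSetting_mem_possibleImages_iff p k _ vQ U).1 hU⟩
  image_fin := fun _ => Set.toFinite _
  hul_nonempty := (naiveSetting_bridgeHyps p).hul_nonempty
  theta_nonempty := fun i vQ => by rw [glueSetting_thetaRegion3]; exact ⟨0, zero_mem_pBall p _ vQ _⟩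
  finite := glueSetting_thetaFinite p k

/-! ## 3. The typed Corollary is a condition on the free glue parameter alone -/

/-- **`(glueSetting p k).Statement ↔ k ≤ 1`**: over the contentful typed-Thm-3.11 instance `naiveFull p` the
typed Corollary 3.12 holds for the glue `B_k` exactly when `k ≤ 1` (`−log p ≤ −k·log p`). [folklore] -/
theorem glueSetting_statement_iff : (glueSetting p k).Statement ↔ k ≤ 1 := by
  have hlog := log_p_pos p
  constructor
  · rintro ⟨-, hle⟩
    rw [glueSetting_negLogQ, glueSetting_negLogTheta, WithTop.coe_le_coe] at hle
    have hk : (k : ℝ) ≤ 1 := by nlinarith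
    exact_mod_cast hk
  · intro hk
    refine ⟨by rw [glueSetting_negLogTheta]; exact WithTop.coe_ne_top, ?_⟩
    rw [glueSetting_negLogQ, glueSetting_negLogTheta, WithTop.coe_le_coe]
    have hk' : (k : ℝ) ≤ 1 := by exact_mod_cast hk
    nlinarith

/-- The glue `B_{-1}` (radius `p`) satisfies the typed Corollary: `−|log(Θ)| = +log p > −log p`. [folklore] -/
theorem glueSetting_neg_one_statement : (glueSetting p (-1)).Statement :=
  (glueSetting_statement_iff p (-1)).2 (by norm_num)

/-- The glue `B_2` violates the typed Corollary: `−|log(Θ)| = −2·log p < −log p`. [folklore] -/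
theorem glueSetting_two_not_statement : ¬ (glueSetting p 2).Statement :=
  fun h => absurd ((glueSetting_statement_iff p 2).1 h) (by norm_num)

/-- **GLUE DECOUPLING over a contentful Thm. 3.11 instance** ([IUTchIII] Cor. 3.12; ADJUDICATION-SPEC §2 (G3)
wording).  There are a type of indices `T`, a CONTENTFUL instantiation `F` of the typed Theorem 3.11 (i) ∧ (ii) ∧
(iii) (abc-iut-w5-d247's `naiveFull 2`, with its contentfulness census in `thm311_contentful_not_imp_statement`),
and TWO verbatim `Cor312.Setting`s `P`, `P′` over that same `F` — abc-iut-w5-d247's `naiveSetting 2` and the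
glue-`(−1)` setting, which differ ONLY in the free Θ-glue field — such that both satisfy every bridge
hypothesis and `|log(q)| > 0`, the typed Corollary 3.12 FAILS for `P` and HOLDS for `P′`.  So at the frozen
typing the Statement is decided by RESIDUAL R1 (the Θ-glue) alone, even over contentful Thm. 3.11 data: the
(G3) countermodels certify non-derivability from the typed interfaces, and the tie across the link is exactly
the gap row G-c312-9-1.  Interface level; no judgement on print. [folklore] -/
theorem statement_decided_by_glue_over_contentful_thm311 :
    ∃ (T : ThetaIndex) (F : FullSituation T) (P P' : Setting F.toLatticeSituation.toSituation),
      F.Statement ∧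
      (BridgeHyps P ∧ P.AbsLogQPos ∧ ¬ P.Statement) ∧
      (BridgeHyps P' ∧ P'.AbsLogQPos ∧ P'.Statement) := by
  haveI : Fact (Nat.Prime 2) := ⟨Nat.prime_two⟩
  exact ⟨toyIndex, naiveFull 2, naiveSetting 2, glueSetting 2 (-1), naiveFull_statement 2,
    ⟨naiveSetting_bridgeHyps 2, naiveSetting_absLogQPos 2, naiveSetting_not_statement 2⟩,
    ⟨glueSetting_bridgeHyps 2 (-1), glueSetting_absLogQPos 2 (-1), glueSetting_neg_one_statement 2⟩⟩

end NaiveWitness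

end Cor312Vol

end IUTFork

end Summit.ABC

end
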